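import Mathlib
import Summits.QuantumFields.YangMills.Theorems.TransportFieldFanoVacuumMagneticEnergy
import HarnessLib

/-!
# The ELECTRIC (temporal-plaquette) ENERGY of the exact zero-flux vacuum pair measure is `O(1/β)` WITHOUT `log β`:
# `∫∫ Ω K_β Ω · Σₑ(2 − Re tr UₑVₑ⁻¹) ≤ (2/β)·λ₀·(6|E| − log c_L)` for `β ≥ 1` (route `TransportFieldFano`, crux ⟨stmt-QuantumFields-23362⟩ helper lane)

Sequel to `…TransportFieldFanoVacuumMagneticEnergy` (magnetic half).  The tree's ✓`AdjointLoopFano.vacuum_mean_temporal_plaquette_le` bounds the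
summed temporal plaquette of the vacuum pair measure `Ω(U)K_β(U,V)Ω(V) dU dV` (mass `λ₀`) by `(2/β)λ₀Γ(β,L)` with `Γ = O(|E| log β)`, because it
uses the POLYNOMIAL floor `λ₀ ≥ poly(β)^{−2|E|}e^{−8|P|−2|E|}c_β^{|E|}` and the one-sided one-link bounds `c_β ≥ e^{2β}w₀/(4β²)`, `c_{β/2} ≤ e^β`.
Here the `log β` is removed — the Gaussian entropies of `c_β` and `c_{β/2}` cancel exactly:
* §1 ★ `linkC_ge_gauss` — the SHARP lower law `c_β ≥ e^{2β}·e^{−1/2}(8/(3π³))·(1/(2β))^{3/2}` (`β ≥ 1`; ✓`windowMass_ge` at `r = 1/√β`,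
  ✓`ballVol_ge_threeHalves`, ✓`windowMass_le_linkC` — the tree's `linkC_ge_poly` weakened `x√x ≥ x²`, we do not);
  ★ `log_linkC_sub_log_linkC_half_ge` — `β − 6 ≤ log c_β − log c_{β/2}` (`β ≥ 1`; with the tree's Gaussian upper bound ✓`linkC_le_gauss` at `β/2`;
  the absolute constant is `½ + log(3π³/8) + (3/2)log(4π) − log(2π²) ≈ 3.77 ≤ 6`);
* §2 ★ `log_tilt_ratio_le_uniform` — `log(e^{β|E|} c_{β/2}^{|E|}/λ₀) ≤ 6|E| − log uniformFloorConst L` (β-uniform floor ✓`levelValue_zero_ge_uniform`);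
* §3 ★★ `vacuum_electric_energy_le_of_nonneg` / ★★ `vacuum_electric_energy_le` — for `β ≥ 1` and every `l2`-normalised physical `Ω` with
  `K_βΩ = λ₀Ω` (sign-free by Perron–Frobenius): `∫∫ Ω(U)K_β(U,V)Ω(V)(2|E| − timeCoupling(U,V)) ≤ (2/β)·λ₀·(6|E| − log uniformFloorConst L)`
  (the Jensen/tilt argument of the tree theorem verbatim, with §2 as the budget);
(The single-plaquette corollary — the `w ≡ const` instance of the weighted temporal-plaquette mean of LINE g17-A — is the sequel
`…TransportFieldFanoVacuumLinkPlaquette`.)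

`−log uniformFloorConst L = O(L³ log L)` is β-FREE.  HONEST FRAMING: fixed-lattice helper estimates (`--supports 23362`); no stub, crux, rung or
summit statement is proved; nothing about infinite volume, the continuum or the Yang–Mills mass gap.  No `sorry`, no new definition.
References: [cite: ReedSimonIV1978, Thm. XIII.1 and XIII.43]; [cite: Luscher1983, §2–3]; [cite: MontvayMunster1994, §3.2.3 (3.97) p.121].
-/

set_option autoImplicit false

noncomputable section

open MeasureTheory Filter Topology Real
open Literature.MathematicalPhysics.QuantumFieldTheory (GaugeConfig Site Edge Plaquette gaugeTransform wilsonAction)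
open Literature.MathematicalPhysics.QuantumLattice (fundamentalRep_apply secondCountableTopology_su2)

namespace Summit.QuantumFields.YangMills.Theorems.TransportFieldFano

open Summit.QuantumFields.YangMills.Theorems.FemtoTransferGap
open Summit.QuantumFields.YangMills.Theorems.AdjointLoopFano

variable {L : ℕ} [NeZero L]

/-! ## §1 The one-link normaliser: sharp Gaussian lower law and the `β ↦ β/2` ratio -/

omit [NeZero L] in
/-- ★ **Sharp Gaussian lower law** `c_β ≥ e^{2β}·e^{−1/2}·(8/(3π³))·((1/(2β))·√(1/(2β)))` for `β ≥ 1` (window mass at radius `1/√β` and the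
`t^{3/2}` law of the Hilbert–Schmidt ball). [cite: MontvayMunster1994, §3.2.3 (3.97) p.121] -/
theorem linkC_ge_gauss {β : ℝ} (hβ : 1 ≤ β) :
    Real.exp (2 * β) * (Real.exp (-(1 / 2 : ℝ)) * (8 / (3 * π ^ 3)) * (1 / β / 2 * Real.sqrt (1 / β / 2))) ≤ linkC β := by
  have hβ0 : 0 < β := by linarith
  have hsβ : 0 < Real.sqrt β := Real.sqrt_pos.2 hβ0
  have hsβ1 : 1 ≤ Real.sqrt β := by rw [← Real.sqrt_one]; exact Real.sqrt_le_sqrt hβ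
  have h1 := windowMass_le_linkC hβ0.le (1 / Real.sqrt β)
  have h2 := windowMass_ge hβ0.le (1 / Real.sqrt β)
  have hr2 : (1 / Real.sqrt β) ^ 2 = 1 / β := by rw [div_pow, one_pow, Real.sq_sqrt hβ0.le]
  have hexp : Real.exp (-(β * (1 / Real.sqrt β) ^ 2 / 2)) = Real.exp (-(1 / 2 : ℝ)) := by
    rw [hr2]; congr 1; field_simp
  have h3 := ballVol_ge_threeHalves (r := 1 / Real.sqrt β) (by positivity) (by rw [div_le_iff₀ hsβ]; linarith)
  rw [hr2] at h3
  rw [hexp] at h2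
  calc Real.exp (2 * β) * (Real.exp (-(1 / 2 : ℝ)) * (8 / (3 * π ^ 3)) * (1 / β / 2 * Real.sqrt (1 / β / 2)))
      = Real.exp (2 * β) * Real.exp (-(1 / 2 : ℝ)) * (8 / (3 * π ^ 3) * (1 / β / 2 * Real.sqrt (1 / β / 2))) := by ring
    _ ≤ Real.exp (2 * β) * Real.exp (-(1 / 2 : ℝ)) * ballVol (1 / Real.sqrt β) :=
        mul_le_mul_of_nonneg_left h3 (by positivity)
    _ ≤ linkC β := h2.trans h1

omit [NeZero L] in
/-- The absolute constant of the one-link ratio: `½ + log(3π³/8) + (3/2) log(4π) − log(2π²) ≤ 6` (`π < 4`, `log 2 < 0.6932`). [folklore] -/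
theorem linkC_ratio_const_le_six :
    1 / 2 + Real.log (3 * π ^ 3 / 8) + 3 / 2 * Real.log (4 * π) - Real.log (2 * π ^ 2) ≤ 6 := by
  have hπ3 := Real.pi_gt_three
  have hπ4 := Real.pi_lt_four
  have hπ0 : 0 < π := Real.pi_pos
  have hl2 := Real.log_two_lt_d9
  have hl2' := Real.log_two_gt_d9
  -- `log(3π³/8) ≤ log 32 = 5 log 2`
  have h1 : Real.log (3 * π ^ 3 / 8) ≤ 5 * Real.log 2 := by
    have h : 3 * π ^ 3 / 8 ≤ 2 ^ 5 := by nlinarith [pow_lt_pow_left₀ hπ4 hπ0.le three_ne_zero]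
    calc Real.log (3 * π ^ 3 / 8) ≤ Real.log (2 ^ 5) := Real.log_le_log (by positivity) h
      _ = 5 * Real.log 2 := by rw [Real.log_pow]; norm_num
  -- `log(4π) ≤ log 16 = 4 log 2`
  have h2 : Real.log (4 * π) ≤ 4 * Real.log 2 := by
    have h : 4 * π ≤ 2 ^ 4 := by nlinarith
    calc Real.log (4 * π) ≤ Real.log (2 ^ 4) := Real.log_le_log (by positivity) h
      _ = 4 * Real.log 2 := by rw [Real.log_pow]; norm_num
  -- `log(2π²) ≥ log 16 = 4 log 2`
  have h3 : 4 * Real.log 2 ≤ Real.log (2 * π ^ 2) := by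
    have h : (2 : ℝ) ^ 4 ≤ 2 * π ^ 2 := by nlinarith
    calc 4 * Real.log 2 = Real.log (2 ^ 4) := by rw [Real.log_pow]; norm_num
      _ ≤ Real.log (2 * π ^ 2) := Real.log_le_log (by positivity) h
  nlinarith

omit [NeZero L] in
/-- ★ **One-link ratio**: `β − 6 ≤ log c_β − log c_{β/2}` for `β ≥ 1` — the Gaussian entropies `(3/2) log β` of the sharp lower law for `c_β`
and of the Gaussian upper law ✓`linkC_le_gauss` for `c_{β/2}` cancel, leaving `β` minus an absolute constant (`≈ 3.77 ≤ 6`).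
[cite: MontvayMunster1994, §3.2.3 (3.97) p.121] -/
theorem log_linkC_sub_log_linkC_half_ge {β : ℝ} (hβ : 1 ≤ β) :
    β - 6 ≤ Real.log (linkC β) - Real.log (linkC (β / 2)) := by
  have hβ0 : 0 < β := by linarith
  have hπ0 : 0 < π := Real.pi_pos
  -- lower bound on `log c_β`
  set x : ℝ := 1 / β / 2 with hx
  have hx0 : 0 < x := by positivity
  have hxe : x = (2 * β)⁻¹ := by rw [hx]; field_simp
  have hlow0 : 0 < Real.exp (2 * β) * (Real.exp (-(1 / 2 : ℝ)) * (8 / (3 * π ^ 3)) * (x * Real.sqrt x)) := by positivity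
  have hlow := (Real.log_le_log_iff hlow0 (linkC_pos hβ0.le)).2 (linkC_ge_gauss hβ)
  have hlogx : Real.log (x * Real.sqrt x) = 3 / 2 * Real.log x := by
    rw [Real.log_mul hx0.ne' (Real.sqrt_pos.2 hx0).ne', Real.log_sqrt hx0.le]; ring
  have hlogx' : Real.log x = -Real.log (2 * β) := by rw [hxe, Real.log_inv]
  rw [Real.log_mul (by positivity) (by positivity), Real.log_exp, Real.log_mul (by positivity) (by positivity),
    Real.log_mul (by positivity) (by positivity), Real.log_exp, hlogx, hlogx'] at hlow
  -- upper bound on `log c_{β/2}`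
  have hhalf0 : 0 < β / 2 := by positivity
  have hup0 : 0 < Real.exp (2 * (β / 2)) * Real.sqrt (π / (β / 2)) ^ 3 / (2 * π ^ 2) := by positivity
  have hup := (Real.log_le_log_iff (linkC_pos hhalf0.le) hup0).2 (linkC_le_gauss hhalf0)
  have hs0 : 0 < Real.sqrt (π / (β / 2)) := Real.sqrt_pos.2 (by positivity)
  have hlogs : Real.log (Real.sqrt (π / (β / 2)) ^ 3) = 3 / 2 * Real.log (4 * π / (2 * β)) := by
    rw [Real.log_pow, Real.log_sqrt (by positivity)]
    have : π / (β / 2) = 4 * π / (2 * β) := by field_simp; ring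
    rw [this]; push_cast; ring
  rw [Real.log_div (by positivity) (by positivity), Real.log_mul (by positivity) (by positivity), Real.log_exp, hlogs,
    Real.log_div (by positivity) (by positivity)] at hup
  -- the constant
  have hκ := linkC_ratio_const_le_six
  have hsplit : Real.log (8 / (3 * π ^ 3)) = -Real.log (3 * π ^ 3 / 8) := by
    rw [← Real.log_inv]; congr 1; field_simp
  rw [hsplit] at hlow
  have h4π : Real.log (4 * π) = Real.log (4 * π / (2 * β)) + Real.log (2 * β) := by
    rw [Real.log_div (by positivity) (by positivity)]; ring
  linarith

/-! ## §2 The log-ratio budget against the β-uniform floor -/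

/-- ★ **Log-ratio budget, β-uniform**: `log(e^{β|E|} c_{β/2}^{|E|}/λ₀) ≤ 6|E| − log uniformFloorConst L` for `β ≥ 1` — the `β|E|` terms and the
`|E| log β` terms both cancel. [cite: Luscher1983, §2] -/
theorem log_tilt_ratio_le_uniform {β : ℝ} (hβ : 1 ≤ β) :
    Real.log (Real.exp (β * Fintype.card (Edge 3 L)) * latCE L (β / 2) / topValue su2Rep L β) ≤
      6 * Fintype.card (Edge 3 L) - Real.log (uniformFloorConst L) := by
  have hβ0 : 0 < β := by linarith
  set E : ℕ := Fintype.card (Edge 3 L) with hE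
  have hT := topValue_su2Rep_pos L β
  have hu : 0 < uniformFloorConst L := uniformFloorConst_pos
  have hfloor : uniformFloorConst L * latCE L β ≤ topValue su2Rep L β := by
    have h := levelValue_zero_ge_uniform (L := L) hβ
    rw [levelValue_zero] at h
    exact h
  have hcβ : 0 < linkC β := linkC_pos hβ0.le
  have hch : 0 < linkC (β / 2) := linkC_pos (by positivity)
  have hnum0 : 0 < Real.exp (β * E) * latCE L (β / 2) := mul_pos (Real.exp_pos _) (latCE_pos (by positivity))
  rw [Real.log_div hnum0.ne' hT.ne', Real.log_mul (Real.exp_pos _).ne' (latCE_pos (by positivity)).ne', Real.log_exp]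
  have h1 : Real.log (latCE L (β / 2)) = E * Real.log (linkC (β / 2)) := by unfold latCE; rw [← hE, Real.log_pow]
  have h2 : Real.log (uniformFloorConst L) + E * Real.log (linkC β) ≤ Real.log (topValue su2Rep L β) := by
    have h := (Real.log_le_log_iff (mul_pos hu (latCE_pos hβ0.le)) hT).2 hfloor
    rw [Real.log_mul hu.ne' (latCE_pos hβ0.le).ne'] at h
    unfold latCE at h; rw [← hE, Real.log_pow] at h
    exact h
  have h3 := log_linkC_sub_log_linkC_half_ge hβ
  have hE0 : (0 : ℝ) ≤ E := Nat.cast_nonneg _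
  rw [h1]
  nlinarith

/-! ## §3 The electric energy of the vacuum pair measure -/

/-- ★★ **Vacuum electric energy, non-negative representative** (`β ≥ 1`; `Ω ≥ 0` physical, `‖Ω‖ = 1`, `K_βΩ = λ₀Ω`):
`∫∫ Ω(U)K_β(U,V)Ω(V)(2|E| − timeCoupling(U,V)) ≤ (2/β)·λ₀·(6|E| − log uniformFloorConst L)` — the summed temporal plaquette
`Σₑ(1 − ½Re tr UₑVₑ⁻¹)` of the vacuum pair PROBABILITY measure is `O((|E| + L³ log L)/β)`, no `log β`.  Jensen with the tilt
`X = (β/2)(2|E| − timeCoupling)` exactly as in ✓`vacuum_mean_temporal_plaquette_le`, budget `log_tilt_ratio_le_uniform`.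
[cite: Luscher1983, §2] [cite: ReedSimonIV1978, Thm. XIII.1] -/
theorem vacuum_electric_energy_le_of_nonneg {β : ℝ} (hβ : 1 ≤ β) {Ω : GaugeConfig 3 L SU2 → ℝ} (hΩ : IsPhys Ω)
    (hΩnn : ∀ U, 0 ≤ Ω U) (hn : l2 Ω Ω = 1) (heig : transferApply β Ω = topValue su2Rep L β • Ω) :
    ∫ p, Ω p.1 * transferKernel su2Rep β p.1 p.2 * Ω p.2 * (2 * Fintype.card (Edge 3 L) - timeCoupling su2Rep p.1 p.2)
        ∂(configMeasure SU2 L).prod (configMeasure SU2 L) ≤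
      (2 / β) * topValue su2Rep L β * (6 * Fintype.card (Edge 3 L) - Real.log (uniformFloorConst L)) := by
  haveI : SecondCountableTopology SU2 := secondCountableTopology_su2
  have hβ0 : 0 < β := by linarith
  set μ2 : Measure (GaugeConfig 3 L SU2 × GaugeConfig 3 L SU2) := (configMeasure SU2 L).prod (configMeasure SU2 L) with hμ2
  set E : ℕ := Fintype.card (Edge 3 L) with hE
  set T : ℝ := topValue su2Rep L β with hT_def
  have hT : 0 < T := topValue_su2Rep_pos L β
  obtain ⟨CΩ, hCΩ⟩ := hΩ.bounded
  have hCΩ0 : 0 ≤ CΩ := (abs_nonneg _).trans (hCΩ (fun _ => 1))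
  set w : GaugeConfig 3 L SU2 × GaugeConfig 3 L SU2 → ℝ := fun p => Ω p.1 * transferKernel su2Rep β p.1 p.2 * Ω p.2 with hw_def
  set X : GaugeConfig 3 L SU2 × GaugeConfig 3 L SU2 → ℝ := fun p => β / 2 * (2 * E - timeCoupling su2Rep p.1 p.2) with hX_def
  have hw0 : ∀ p, 0 ≤ w p := fun p =>
    mul_nonneg (mul_nonneg (hΩnn _) (transferKernel_pos _ _ _ _).le) (hΩnn _)
  have hX0 : ∀ p, 0 ≤ X p := fun p => by
    have := timeCoupling_le_two_card (L := L) p.1 p.2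
    rw [hX_def]; dsimp only; rw [← hE] at this; exact mul_nonneg (by positivity) (by linarith)
  have hXle : ∀ p, X p ≤ 2 * β * E := fun p => by
    have := neg_two_card_le_timeCoupling (L := L) p.1 p.2
    rw [hX_def]; dsimp only; rw [← hE] at this; nlinarith
  have hKm : Measurable fun p : GaugeConfig 3 L SU2 × GaugeConfig 3 L SU2 => transferKernel su2Rep β p.1 p.2 :=
    measurable_transferKernel_lat β
  have htcm : Measurable fun p : GaugeConfig 3 L SU2 × GaugeConfig 3 L SU2 => timeCoupling su2Rep p.1 p.2 :=
    (continuous_timeCoupling su2Rep continuous_su2Rep).measurable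
  have hwm : Measurable w := ((hΩ.measurable.comp measurable_fst).mul hKm).mul (hΩ.measurable.comp measurable_snd)
  have hXm : Measurable X := measurable_const.mul (measurable_const.sub htcm)
  have hKb : ∀ p : GaugeConfig 3 L SU2 × GaugeConfig 3 L SU2, |transferKernel su2Rep β p.1 p.2| ≤ Real.exp (2 * β) ^ E :=
    fun p => abs_transferKernel_le_lat hβ0.le p
  have hwb : ∀ p, |w p| ≤ CΩ * Real.exp (2 * β) ^ E * CΩ := fun p => by
    rw [hw_def]; dsimp only; rw [abs_mul, abs_mul]
    exact mul_le_mul (mul_le_mul (hCΩ _) (hKb p) (abs_nonneg _) hCΩ0) (hCΩ _) (abs_nonneg _) (by positivity)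
  have hXb : ∀ p, |X p| ≤ 2 * β * E := fun p => by rw [abs_of_nonneg (hX0 p)]; exact hXle p
  have hwi : Integrable w μ2 := integrable_latProd hwm hwb
  have hXwi : Integrable (fun p => X p * w p) μ2 :=
    integrable_latProd (hXm.mul hwm) (C := 2 * β * E * (CΩ * Real.exp (2 * β) ^ E * CΩ)) fun p => by
      rw [abs_mul]; exact mul_le_mul (hXb p) (hwb p) (abs_nonneg _) (by positivity)
  have heXwi : Integrable (fun p => Real.exp (X p) * w p) μ2 :=
    integrable_latProd ((Real.measurable_exp.comp hXm).mul hwm)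
      (C := Real.exp (2 * β * E) * (CΩ * Real.exp (2 * β) ^ E * CΩ)) fun p => by
      rw [abs_mul, abs_of_pos (Real.exp_pos _)]
      exact mul_le_mul (Real.exp_le_exp.2 (hXle p)) (hwb p) (abs_nonneg _) (Real.exp_pos _).le
  have hwT : ∫ p, w p ∂μ2 = T := by
    rw [hw_def, hμ2, ← qform_eq_integral_latProd hβ0.le hΩ, qform_eq_l2_transferApply, heig, l2_comm, l2_smul_left, hn, mul_one]
  set M : ℝ := ∫ p, Real.exp (X p) * w p ∂μ2 with hM_def
  have hMle : M ≤ Real.exp (β * E) * latCE L (β / 2) := by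
    have hpt : ∀ p, Real.exp (X p) * w p ≤
        Real.exp (β * E) * (latE L (β / 2) p.1 p.2 * (Ω p.1 ^ 2) / 2 + latE L (β / 2) p.1 p.2 * (Ω p.2 ^ 2) / 2) := by
      intro p
      have h1 := exp_tilt_mul_transferKernel_le (L := L) hβ0.le p.1 p.2
      rw [← hE] at h1
      have h2 : Real.exp (X p) * w p = (Real.exp (X p) * transferKernel su2Rep β p.1 p.2) * (Ω p.1 * Ω p.2) := by
        rw [hw_def]; ring
      rw [h2]
      have hΩΩ : 0 ≤ Ω p.1 * Ω p.2 := mul_nonneg (hΩnn _) (hΩnn _)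
      have hamgm : Ω p.1 * Ω p.2 ≤ (Ω p.1 ^ 2 + Ω p.2 ^ 2) / 2 := by nlinarith [sq_nonneg (Ω p.1 - Ω p.2)]
      have hE0 : 0 ≤ Real.exp (β * ↑E) * latE L (β / 2) p.1 p.2 := mul_nonneg (Real.exp_pos _).le (latE_pos _ _ _).le
      calc Real.exp (X p) * transferKernel su2Rep β p.1 p.2 * (Ω p.1 * Ω p.2)
          ≤ Real.exp (β * E) * latE L (β / 2) p.1 p.2 * (Ω p.1 * Ω p.2) := mul_le_mul_of_nonneg_right h1 hΩΩ
        _ ≤ Real.exp (β * E) * latE L (β / 2) p.1 p.2 * ((Ω p.1 ^ 2 + Ω p.2 ^ 2) / 2) := mul_le_mul_of_nonneg_left hamgm hE0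
        _ = Real.exp (β * E) * (latE L (β / 2) p.1 p.2 * (Ω p.1 ^ 2) / 2 + latE L (β / 2) p.1 p.2 * (Ω p.2 ^ 2) / 2) := by ring
    have hfst := integral_prod_latE_mul_fst (L := L) (β / 2) (hΩ.measurable.pow_const 2) (C := CΩ * CΩ)
      (fun U => by rw [abs_pow, sq]; exact mul_le_mul (hCΩ U) (hCΩ U) (abs_nonneg _) hCΩ0) (by positivity)
    have hsnd := integral_prod_latE_mul_snd (L := L) (β / 2) (hΩ.measurable.pow_const 2) (C := CΩ * CΩ)
      (fun U => by rw [abs_pow, sq]; exact mul_le_mul (hCΩ U) (hCΩ U) (abs_nonneg _) hCΩ0) (by positivity)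
    have hΩ2int : ∫ U, Ω U ^ 2 ∂configMeasure SU2 L = 1 := by
      rw [← hn]; unfold l2; exact integral_congr_ae (ae_of_all _ fun U => by ring)
    have hi1 : Integrable (fun p : GaugeConfig 3 L SU2 × GaugeConfig 3 L SU2 => latE L (β / 2) p.1 p.2 * Ω p.1 ^ 2) μ2 :=
      integrable_latProd ((measurable_latE (β / 2)).mul ((hΩ.measurable.pow_const 2).comp measurable_fst))
        (C := Real.exp (2 * (β / 2)) ^ E * (CΩ * CΩ)) fun p => by
        rw [abs_mul]
        exact mul_le_mul (abs_latE_le (by positivity) _ _)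
          (by rw [abs_pow, sq]; exact mul_le_mul (hCΩ _) (hCΩ _) (abs_nonneg _) hCΩ0) (abs_nonneg _) (by positivity)
    have hi2 : Integrable (fun p : GaugeConfig 3 L SU2 × GaugeConfig 3 L SU2 => latE L (β / 2) p.1 p.2 * Ω p.2 ^ 2) μ2 :=
      integrable_latProd ((measurable_latE (β / 2)).mul ((hΩ.measurable.pow_const 2).comp measurable_snd))
        (C := Real.exp (2 * (β / 2)) ^ E * (CΩ * CΩ)) fun p => by
        rw [abs_mul]
        exact mul_le_mul (abs_latE_le (by positivity) _ _)
          (by rw [abs_pow, sq]; exact mul_le_mul (hCΩ _) (hCΩ _) (abs_nonneg _) hCΩ0) (abs_nonneg _) (by positivity)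
    have hrhs_int : Integrable (fun p : GaugeConfig 3 L SU2 × GaugeConfig 3 L SU2 =>
        Real.exp (β * E) * (latE L (β / 2) p.1 p.2 * (Ω p.1 ^ 2) / 2 + latE L (β / 2) p.1 p.2 * (Ω p.2 ^ 2) / 2)) μ2 :=
      ((hi1.div_const 2).add (hi2.div_const 2)).const_mul _
    have hmono := integral_mono heXwi hrhs_int hpt
    have hrhs : ∫ p, Real.exp (β * E) * (latE L (β / 2) p.1 p.2 * (Ω p.1 ^ 2) / 2 + latE L (β / 2) p.1 p.2 * (Ω p.2 ^ 2) / 2) ∂μ2 =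
        Real.exp (β * E) * latCE L (β / 2) := by
      rw [integral_const_mul, integral_add (hi1.div_const 2) (hi2.div_const 2), integral_div, integral_div, hμ2, hfst, hsnd, hΩ2int]
      ring
    rw [hrhs] at hmono
    exact hmono
  have hMpos : 0 < M := by
    have hge : ∫ p, w p ∂μ2 ≤ M := integral_mono hwi heXwi fun p => by
      have : 1 ≤ Real.exp (X p) := Real.one_le_exp (hX0 p)
      nlinarith [hw0 p]
    linarith
  have hJ := integral_mul_le_mul_log μ2 hw0 hT hwT hXwi heXwi hwi rfl hMpos
  have hlog : Real.log (M / T) ≤ 6 * E - Real.log (uniformFloorConst L) := by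
    have h1 : Real.log (M / T) ≤ Real.log (Real.exp (β * E) * latCE L (β / 2) / T) :=
      Real.log_le_log (div_pos hMpos hT) (div_le_div_of_nonneg_right hMle hT.le)
    exact h1.trans (by have := log_tilt_ratio_le_uniform (L := L) hβ; rw [← hE] at this; exact this)
  have hconv : (fun p : GaugeConfig 3 L SU2 × GaugeConfig 3 L SU2 =>
      Ω p.1 * transferKernel su2Rep β p.1 p.2 * Ω p.2 * (2 * E - timeCoupling su2Rep p.1 p.2)) =
      fun p => (2 / β) * (X p * w p) := by
    funext p
    rw [hX_def, hw_def]; dsimp only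
    field_simp
  rw [hconv, integral_const_mul]
  have h2β : 0 ≤ 2 / β := by positivity
  calc 2 / β * ∫ p, X p * w p ∂μ2 ≤ 2 / β * (T * Real.log (M / T)) := mul_le_mul_of_nonneg_left hJ h2β
    _ ≤ 2 / β * (T * (6 * E - Real.log (uniformFloorConst L))) :=
        mul_le_mul_of_nonneg_left (mul_le_mul_of_nonneg_left hlog hT.le) h2β
    _ = _ := by ring

/-- ★★ **VACUUM ELECTRIC ENERGY** (`β ≥ 1`, every `L`): for every `l2`-normalised physical `Ω` with `K_βΩ = λ₀Ω`,
`∫∫ Ω(U)K_β(U,V)Ω(V)(2|E| − timeCoupling(U,V)) dU dV ≤ (2/β)·λ₀·(6|E| − log uniformFloorConst L)`: the summed temporal plaquette of the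
exact vacuum pair probability measure is `O((|E| + L³ log L)/β)`, uniformly in `β ≥ 1` (no `log β`).  Sign-free by Perron–Frobenius–Jentzsch
(`Ω = ±|c|Ω₊` a.e., the pair integral is even in `Ω`). [cite: ReedSimonIV1978, Thm. XIII.43] [cite: Luscher1983, §2] -/
theorem vacuum_electric_energy_le {β : ℝ} (hβ : 1 ≤ β) {Ω : GaugeConfig 3 L SU2 → ℝ} (hΩ : IsPhys Ω)
    (hn : l2 Ω Ω = 1) (heig : transferApply β Ω = topValue su2Rep L β • Ω) :
    ∫ p, Ω p.1 * transferKernel su2Rep β p.1 p.2 * Ω p.2 * (2 * Fintype.card (Edge 3 L) - timeCoupling su2Rep p.1 p.2)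
        ∂(configMeasure SU2 L).prod (configMeasure SU2 L) ≤
      (2 / β) * topValue su2Rep L β * (6 * Fintype.card (Edge 3 L) - Real.log (uniformFloorConst L)) := by
  obtain ⟨Ωp, θ, cp, hΩp, hcp, hΩpge, hnp, heigp, -, hθ, hgap⟩ := PhysL2.exists_groundState (L := L) β
  set c : ℝ := l2 Ω Ωp with hc
  have hae : Ω =ᵐ[configMeasure SU2 L] fun U => c * Ωp U := ae_eq_smul_groundState hΩ hΩp hnp heig heigp hθ hgap
  set σ : ℝ := if 0 ≤ c then 1 else -1 with hσ
  have hσ2 : σ * σ = 1 := by rw [hσ]; split_ifs <;> norm_num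
  have hσc : σ * |c| = c := by
    rw [hσ]; split_ifs with h
    · rw [abs_of_nonneg h, one_mul]
    · rw [abs_of_neg (not_le.mp h)]; ring
  set Ω'' : GaugeConfig 3 L SU2 → ℝ := fun U => |c| * Ωp U with hΩ''_def
  have hΩ'' : IsPhys Ω'' := by
    have h := hΩp.smul |c|
    have e : (|c| • Ωp) = Ω'' := by funext U; simp [hΩ''_def]
    rw [← e]; exact h
  have hΩ''nn : ∀ U, 0 ≤ Ω'' U := fun U => mul_nonneg (abs_nonneg c) (hcp.le.trans (hΩpge U))
  have heig'' : transferApply β Ω'' = topValue su2Rep L β • Ω'' := by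
    have e : Ω'' = |c| • Ωp := by funext U; simp [hΩ''_def]
    rw [e, transferApply_smul, heigp, smul_smul, smul_smul, mul_comm]
  have haeσ : Ω =ᵐ[configMeasure SU2 L] fun U => σ * Ω'' U := by
    filter_upwards [hae] with U hU
    rw [hU, hΩ''_def]; dsimp only; rw [← mul_assoc, hσc]
  have hn'' : l2 Ω'' Ω'' = 1 := by
    rw [← hn, l2_congr_ae haeσ haeσ]; unfold l2
    refine integral_congr_ae (ae_of_all _ fun U => ?_)
    dsimp only
    have : σ * Ω'' U * (σ * Ω'' U) = σ * σ * (Ω'' U * Ω'' U) := by ring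
    rw [this, hσ2, one_mul]
  have hfst : (fun p : GaugeConfig 3 L SU2 × GaugeConfig 3 L SU2 => Ω p.1) =ᵐ[(configMeasure SU2 L).prod (configMeasure SU2 L)]
      fun p => σ * Ω'' p.1 :=
    (Measure.quasiMeasurePreserving_fst (μ := configMeasure SU2 L) (ν := configMeasure SU2 L)).ae_eq haeσ
  have hsnd : (fun p : GaugeConfig 3 L SU2 × GaugeConfig 3 L SU2 => Ω p.2) =ᵐ[(configMeasure SU2 L).prod (configMeasure SU2 L)]
      fun p => σ * Ω'' p.2 :=
    (Measure.quasiMeasurePreserving_snd (μ := configMeasure SU2 L) (ν := configMeasure SU2 L)).ae_eq haeσ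
  have hRHS : ∫ p, Ω p.1 * transferKernel su2Rep β p.1 p.2 * Ω p.2 * (2 * Fintype.card (Edge 3 L) - timeCoupling su2Rep p.1 p.2)
        ∂(configMeasure SU2 L).prod (configMeasure SU2 L) =
      ∫ p, Ω'' p.1 * transferKernel su2Rep β p.1 p.2 * Ω'' p.2 * (2 * Fintype.card (Edge 3 L) - timeCoupling su2Rep p.1 p.2)
        ∂(configMeasure SU2 L).prod (configMeasure SU2 L) := by
    refine integral_congr_ae ?_
    filter_upwards [hfst, hsnd] with p h1 h2
    have h1' : Ω p.1 = σ * Ω'' p.1 := h1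
    have h2' : Ω p.2 = σ * Ω'' p.2 := h2
    rw [h1', h2']
    have : σ * Ω'' p.1 * transferKernel su2Rep β p.1 p.2 * (σ * Ω'' p.2) * (2 * Fintype.card (Edge 3 L) - timeCoupling su2Rep p.1 p.2) =
        σ * σ * (Ω'' p.1 * transferKernel su2Rep β p.1 p.2 * Ω'' p.2 * (2 * Fintype.card (Edge 3 L) - timeCoupling su2Rep p.1 p.2)) := by
      ring
    rw [this, hσ2, one_mul]
  rw [hRHS]
  exact vacuum_electric_energy_le_of_nonneg hβ hΩ'' hΩ''nn hn'' heig''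

end Summit.QuantumFields.YangMills.Theorems.TransportFieldFano

end
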